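import Literature.NumberTheory.Automorphic.ClozelAlgebraicity
import Literature.NumberTheory.Automorphic.AutomorphicRepsGLSatakeFlathProofs
import HarnessLib

/-!
# Clozel's algebraicity fact: the `Aut(ℂ)`-conjugation relation on Hecke eigensystems (proofs)

Proofs-only companion (theorems, no definitions, no named facts) of `ClozelAlgebraicity.lean`.
There, Clozel's `^σπ_f = π_f ⊗_{ℂ,σ} ℂ` is rendered by the relation `IsAutConjugate σ π π'`
("at almost all finite places the unramified Hecke eigenvalues of `π'` are the `σ`-conjugates
`σ(t_{v,i})` of those of `π`") and `{σ : ^σπ_f ≅ π_f}` by the subgroup `heckeStabilizer π` of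
`Aut(ℂ) = (ℂ ≃ₐ[ℚ] ℂ)`. Using the two theorems of `AutomorphicRepsGLSatakeFlathProofs` — every
automorphic representation of `GL_n(𝔸_K)` has a Satake parameter at almost all places
(`hasSatakeParamAt_cofinite_holds`, Flath) and the parameter at `v` is unique
(`hasSatakeParamAt_unique_holds`) — this file shows that the rendering behaves like the printed
notions (Clozel 1990, §3.1: `σ ↦ ^σπ` is an action of `Aut(ℂ)`; `ℚ(π_f)` is the fixed field of
the stabiliser of `π_f`):

* `eq_of_heckeEigenvalueOf_eq` — the eigenvalues `t_{v,i} = q_v^{i(n-i)/2} e_i(α)`, `i ≤ n`,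
  determine the Satake parameter `α` (a multiset of cardinality `n`);
* `IsAutConjugate.refl`, `.symm`, `.trans` — `IsAutConjugate` is the graph of an action:
  `π ~₁ π`, `π ~_σ π' → π' ~_{σ⁻¹} π`, `π ~_σ π' → π' ~_τ π'' → π ~_{τσ} π''`;
* `IsAutConjugate.isNearlyEquivalent` — two `σ`-conjugates of the same `π` are nearly
  equivalent (same Satake parameters at almost all places), i.e. `^σπ` is well defined up to
  near equivalence (hence, for cuspidal `π'`, `π''`, up to isomorphism by strong multiplicity
  one, Jacquet–Shalika — not restated here);
* `mem_heckeStabilizer_iff_isAutConjugate` — `σ ∈ heckeStabilizer π ↔ IsAutConjugate σ π π`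
  ("`^σπ_f ≅ π_f`"), so that `ratField π` is literally the fixed field of `{σ : ^σπ ~ π}`;
* `mem_heckeStabilizer_iff_of_isAutConjugate`, `mem_ratField_iff_of_isAutConjugate`,
  `finiteDimensional_ratField_of_isAutConjugate` — the stabiliser of a `σ`-conjugate is the
  `σ`-conjugate subgroup, `ℚ(^σπ_f) = σ(ℚ(π_f))`, and clause (i) of the fact ("`ℚ(π_f)` is a
  number field") passes to conjugates.

## References

* L. Clozel, *Motifs et formes automorphes: applications du principe de fonctorialité*, in
  Automorphic forms, Shimura varieties, and L-functions I (Ann Arbor 1988), Academic Press 1990,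
  §3.1 and Thm. 3.13 [Clozel1990].
* D. Flath, *Decomposition of representations into tensor products*, Corvallis 1979, Thm. 3
  [FlathCorvallis1979].
-/

noncomputable section

open scoped Classical
open NumberField IsDedekindDomain

namespace Literature.NumberTheory.Automorphic

variable {n : ℕ} {K : Type} [Field K] [NumberField K] {hcpt : isCompact_glFiniteIntegralLevel n K}

/-- **The unramified Hecke eigenvalues determine the Satake parameter.** If two multisets of
cardinality `n` have the same eigenvalues `t_{v,i} = q_v^{i(n-i)/2} e_i(·)` for `i ≤ n`, they
are equal: `q_v^{i(n-i)/2} ≠ 0` (`sqrt_residueCard_ne_zero`) and a multiset of cardinality `n`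
is determined by `e_0, …, e_n` (`multiset_eq_of_esymm_eq`, Vieta). (Bump, *Automorphic Forms
and Representations*, §3.3; Flath 1979, Thm. 3.) [folklore] -/
theorem eq_of_heckeEigenvalueOf_eq {v : HeightOneSpectrum (𝓞 K)} {α β : Multiset ℂ}
    (hα : Multiset.card α = n) (hβ : Multiset.card β = n)
    (h : ∀ i ≤ n, heckeEigenvalueOf n v α i = heckeEigenvalueOf n v β i) : α = β := by
  refine multiset_eq_of_esymm_eq (hα.trans hβ.symm) fun j hj ↦ ?_
  rw [hα] at hj
  exact mul_left_cancel₀ (pow_ne_zero _ (sqrt_residueCard_ne_zero (K := K) v)) (h j hj)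

namespace IsAutConjugate

/-- **`π` is its own `1`-conjugate**: at the (cofinitely many, `hasSatakeParamAt_cofinite_holds`)
unramified places take `α' = α`. (Clozel 1990, §3.1: `^1π = π`.) [cite: Clozel1990, §3.1] -/
theorem refl (π : AutomorphicRepData (AutomorphyDatum.gl n K hcpt)) : IsAutConjugate 1 π π := by
  change ∀ᶠ v : HeightOneSpectrum (𝓞 K) in Filter.cofinite, _
  filter_upwards [AutomorphicRepData.hasSatakeParamAt_cofinite_holds π] with v hv
  obtain ⟨α, hα⟩ := hv
  exact ⟨α, α, hα, hα, fun i _ ↦ rfl⟩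

/-- **Symmetry**: if `π'` is the `σ`-conjugate of `π` then `π` is the `σ⁻¹`-conjugate of `π'`
(`σ⁻¹ (σ t) = t`). (Clozel 1990, §3.1.) [cite: Clozel1990, §3.1] -/
theorem symm {σ : ℂ ≃ₐ[ℚ] ℂ} {π π' : AutomorphicRepData (AutomorphyDatum.gl n K hcpt)}
    (h : IsAutConjugate σ π π') : IsAutConjugate σ⁻¹ π' π := by
  change ∀ᶠ v : HeightOneSpectrum (𝓞 K) in Filter.cofinite, _ at h ⊢
  filter_upwards [h] with v hv
  obtain ⟨α, α', hα, hα', he⟩ := hv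
  refine ⟨α', α, hα', hα, fun i hi ↦ ?_⟩
  rw [he i hi, AlgEquiv.aut_inv, AlgEquiv.symm_apply_apply]

/-- **Transitivity / action law**: a `τ`-conjugate of a `σ`-conjugate of `π` is a
`τσ`-conjugate of `π` (the Satake parameter of the middle representation at `v` is unique,
`hasSatakeParamAt_unique_holds`). (Clozel 1990, §3.1: `^τ(^σπ) = ^{τσ}π`.) [cite: Clozel1990, §3.1] -/
theorem trans {σ τ : ℂ ≃ₐ[ℚ] ℂ} {π π' π'' : AutomorphicRepData (AutomorphyDatum.gl n K hcpt)}
    (h₁ : IsAutConjugate σ π π') (h₂ : IsAutConjugate τ π' π'') :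
    IsAutConjugate (τ * σ) π π'' := by
  change ∀ᶠ v : HeightOneSpectrum (𝓞 K) in Filter.cofinite, _ at h₁ h₂ ⊢
  filter_upwards [h₁, h₂] with v hv₁ hv₂
  obtain ⟨α, α', hα, hα', he⟩ := hv₁
  obtain ⟨β', β'', hβ', hβ'', hf⟩ := hv₂
  have hαβ : α' = β' := AutomorphicRepData.hasSatakeParamAt_unique_holds π' hα' hβ'
  refine ⟨α, β'', hα, hβ'', fun i hi ↦ ?_⟩
  rw [hf i hi, ← hαβ, he i hi, AlgEquiv.mul_apply]

/-- **`^σπ` is well defined up to near equivalence**: two `σ`-conjugates `π'`, `π''` of the same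
`π` have the same Satake parameters at almost all places (the parameter of `π` at `v` is unique,
and the eigenvalues `σ(t_{v,i})` determine the parameter, `eq_of_heckeEigenvalueOf_eq`). For
cuspidal `π'`, `π''` strong multiplicity one (Jacquet–Shalika 1981) then identifies them.
(Clozel 1990, §3.1.) [cite: Clozel1990, §3.1] -/
theorem isNearlyEquivalent {σ : ℂ ≃ₐ[ℚ] ℂ}
    {π π' π'' : AutomorphicRepData (AutomorphyDatum.gl n K hcpt)}
    (h₁ : IsAutConjugate σ π π') (h₂ : IsAutConjugate σ π π'') :
    AutomorphicRepData.IsNearlyEquivalent π' π'' := by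
  change ∀ᶠ v : HeightOneSpectrum (𝓞 K) in Filter.cofinite, _ at h₁ h₂ ⊢
  filter_upwards [h₁, h₂] with v hv₁ hv₂
  obtain ⟨α, α', hα, hα', he⟩ := hv₁
  obtain ⟨β, β'', hβ, hβ'', hf⟩ := hv₂
  have hαβ : α = β := AutomorphicRepData.hasSatakeParamAt_unique_holds π hα hβ
  have hparam : α' = β'' :=
    eq_of_heckeEigenvalueOf_eq hα'.card_eq hβ''.card_eq fun i hi ↦ by
      rw [he i hi, hf i hi, hαβ]
  exact ⟨α', hα', hparam ▸ hβ''⟩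

end IsAutConjugate

/-- **The Hecke stabiliser is `{σ : ^σπ ~ π}`.** `σ ∈ heckeStabilizer π` (i.e. `σ` fixes every
unramified Hecke eigenvalue of `π` at almost all places) iff `π` is its own `σ`-conjugate at
almost all places. (`→`: take `α' = α` at the unramified places, `hasSatakeParamAt_cofinite_holds`;
`←`: all Satake parameters of `π` at `v` coincide, `hasSatakeParamAt_unique_holds`.) This is the
identification of `ratField π` with Clozel's `ℚ(π_f)`, the fixed field of
`{σ ∈ Aut(ℂ) : ^σπ_f ≅ π_f}` (Clozel 1990, §3.1 and Thm. 3.13), granted that isomorphism of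
finite parts is detected on almost all unramified components (strong multiplicity one). [cite: Clozel1990, §3.1 and Thm. 3.13] -/
theorem mem_heckeStabilizer_iff_isAutConjugate
    (π : AutomorphicRepData (AutomorphyDatum.gl n K hcpt)) (σ : ℂ ≃ₐ[ℚ] ℂ) :
    σ ∈ heckeStabilizer π ↔ IsAutConjugate σ π π := by
  rw [mem_heckeStabilizer_iff]
  constructor
  · intro hσ
    change ∀ᶠ v : HeightOneSpectrum (𝓞 K) in Filter.cofinite, _
    filter_upwards [hσ, AutomorphicRepData.hasSatakeParamAt_cofinite_holds π] with v hv hv'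
    obtain ⟨α, hα⟩ := hv'
    exact ⟨α, α, hα, hα, fun i hi ↦ (hv α hα i hi).symm⟩
  · intro hσ
    change ∀ᶠ v : HeightOneSpectrum (𝓞 K) in Filter.cofinite, _ at hσ
    filter_upwards [hσ] with v hv β hβ i hi
    obtain ⟨α, α', hα, hα', he⟩ := hv
    have hβα : β = α := AutomorphicRepData.hasSatakeParamAt_unique_holds π hβ hα
    have hα'α : α' = α := AutomorphicRepData.hasSatakeParamAt_unique_holds π hα' hα
    rw [hβα]
    rw [hα'α] at he
    exact (he i hi).symm

/-- **The stabiliser of a conjugate is the conjugate stabiliser**: if `π'` is a `σ`-conjugate of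
`π`, then `τ ∈ heckeStabilizer π' ↔ σ⁻¹ τ σ ∈ heckeStabilizer π` (from the action laws
`IsAutConjugate.refl/symm/trans` and `mem_heckeStabilizer_iff_isAutConjugate`). Consequently
`ℚ(^σπ_f) = σ(ℚ(π_f))` (Clozel 1990, §3.1). [cite: Clozel1990, §3.1] -/
theorem mem_heckeStabilizer_iff_of_isAutConjugate {σ : ℂ ≃ₐ[ℚ] ℂ}
    {π π' : AutomorphicRepData (AutomorphyDatum.gl n K hcpt)} (h : IsAutConjugate σ π π')
    (τ : ℂ ≃ₐ[ℚ] ℂ) : τ ∈ heckeStabilizer π' ↔ σ⁻¹ * τ * σ ∈ heckeStabilizer π := by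
  rw [mem_heckeStabilizer_iff_isAutConjugate, mem_heckeStabilizer_iff_isAutConjugate]
  constructor
  · intro hτ
    -- `π ~_σ π' ~_τ π' ~_{σ⁻¹} π`
    have h3 : IsAutConjugate (σ⁻¹ * (τ * σ)) π π := (h.trans hτ).trans h.symm
    rwa [← mul_assoc] at h3
  · intro hτ
    -- `π' ~_{σ⁻¹} π ~_{σ⁻¹τσ} π ~_σ π'`
    have h3 : IsAutConjugate (σ * (σ⁻¹ * τ * σ * σ⁻¹)) π' π' := (h.symm.trans hτ).trans h
    have key : σ * (σ⁻¹ * τ * σ * σ⁻¹) = τ := by group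
    rwa [key] at h3

/-- **`ℚ(^σπ_f) = σ(ℚ(π_f))`**: if `π'` is a `σ`-conjugate of `π`, then `z ∈ ratField π'` iff
`σ⁻¹ z ∈ ratField π` (the stabilisers are conjugate, `mem_heckeStabilizer_iff_of_isAutConjugate`).
(Clozel 1990, §3.1.) [cite: Clozel1990, §3.1] -/
theorem mem_ratField_iff_of_isAutConjugate {σ : ℂ ≃ₐ[ℚ] ℂ}
    {π π' : AutomorphicRepData (AutomorphyDatum.gl n K hcpt)} (h : IsAutConjugate σ π π')
    (z : ℂ) : z ∈ ratField π' ↔ σ.symm z ∈ ratField π := by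
  rw [mem_ratField_iff, mem_ratField_iff]
  constructor
  · intro hz ρ hρ
    -- `τ = σ ρ σ⁻¹` stabilises `π'`
    have hτ : σ * ρ * σ⁻¹ ∈ heckeStabilizer π' := by
      rw [mem_heckeStabilizer_iff_of_isAutConjugate h]
      have key : σ⁻¹ * (σ * ρ * σ⁻¹) * σ = ρ := by group
      rwa [key]
    have e := hz _ hτ
    rw [AlgEquiv.mul_apply, AlgEquiv.mul_apply, AlgEquiv.aut_inv] at e
    -- `e : σ (ρ (σ.symm z)) = z`
    simpa using congrArg σ.symm e
  · intro hz τ hτ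
    rw [mem_heckeStabilizer_iff_of_isAutConjugate h] at hτ
    have e := hz _ hτ
    rw [AlgEquiv.mul_apply, AlgEquiv.mul_apply, AlgEquiv.aut_inv] at e
    -- `e : σ.symm (τ (σ (σ.symm z))) = σ.symm z`
    rw [AlgEquiv.apply_symm_apply] at e
    simpa using congrArg σ e

/-- **Clause (i) is invariant under `Aut(ℂ)`-conjugation**: if `π'` is a `σ`-conjugate of `π`
and `ℚ(π_f) = ratField π` is finite over `ℚ`, so is `ratField π'` — `σ⁻¹` restricts to a
`ℚ`-linear isomorphism `ratField π' ≃ ratField π` (`mem_ratField_iff_of_isAutConjugate`).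
(Clozel 1990, §3.1.) [cite: Clozel1990, §3.1] -/
theorem finiteDimensional_ratField_of_isAutConjugate {σ : ℂ ≃ₐ[ℚ] ℂ}
    {π π' : AutomorphicRepData (AutomorphyDatum.gl n K hcpt)} (h : IsAutConjugate σ π π')
    [FiniteDimensional ℚ (ratField π)] : FiniteDimensional ℚ (ratField π') := by
  let e : ratField π' ≃ₗ[ℚ] ratField π :=
    { toFun := fun z ↦ ⟨σ.symm z, (mem_ratField_iff_of_isAutConjugate h z).mp z.2⟩
      map_add' := fun _ _ ↦ Subtype.ext (by simp)
      map_smul' := fun _ _ ↦ Subtype.ext (by simp [Algebra.smul_def])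
      invFun := fun w ↦ ⟨σ w, by
        rw [mem_ratField_iff_of_isAutConjugate h, AlgEquiv.symm_apply_apply]
        exact w.2⟩
      left_inv := fun z ↦ Subtype.ext (by simp)
      right_inv := fun w ↦ Subtype.ext (by simp) }
  exact LinearEquiv.finiteDimensional e.symm

end Literature.NumberTheory.Automorphic
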